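import Summits.NavierStokesRegularity.NavierStokesRegularity.Theorems.PoloidalWindowDoorPoloidalWindowRigidityZShockRotatingProfileLogPolar
import Summits.NavierStokesRegularity.NavierStokesRegularity.Theorems.PoloidalWindowDoorPoloidalWindowRigidityZShockRotatingProfileAngularMomentum
import Summits.NavierStokesRegularity.NavierStokesRegularity.Theorems.PoloidalWindowDoorPoloidalWindowRigidityZShockRotatingProfileTransport
import Mathlib.Analysis.SpecialFunctions.Sqrt
import HarnessLib

/-!
# Crux K2 `PoloidalWindowRigidity` (stmt-NavierStokesRegularity-19708), line `z_shock` — R3 inhabitant census: ROTATING PATTERNS (XIII) —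
# John's approximate Riemann invariants of a rotating profile in the hyperbolic exterior: the transport identity of part XII
# instantiated with `p = γ(Ψ)XΨ`, `q = ΘΨ`, `m = ω²|y|² − γ(Ψ)`, `λ = √(m γ(Ψ))` (census item F3, entrance)

`--supports stmt-NavierStokesRegularity-19708 --as helper` (leafhand-ns-poloidalwindowdoor-3 g9, cell decomp-ns, 2026-08-31).  Class-free,
def-free; parts II (`…LogPolar`), V (`…AngularMomentum`), XII (`…Transport`) + Mathlib.  **No stub and no summit is closed by this file;
Navier–Stokes regularity is NOT proved here (rung 0).**

WHY THIS FILE.  At a point `y` of the hyperbolic exterior of a rotating profile (`γ(Ψ(y)) < ω²|y|²`; for `γ ≤ γhi` this is `|y| > √γhi/|ω|`)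
the exterior first-order system `X p = Θ(m q)`, `X q = Θ(p/γ(Ψ))` (parts II, V) has the real characteristic speeds `±λ/γ(Ψ)`,
`λ = √(m γ(Ψ)) > 0`.  Part XII's algebraic transport identity therefore applies to `w₊ = γ(Ψ)XΨ + λ ΘΨ` (and to `w₋` with `−λ`):

* ★ `rotating_riemann_transport` — at every exterior point,
  `X w₊ − (λ/γ(Ψ)) Θ w₊ = (Θm + Xλ − (λ/γ(Ψ)) Θλ)·ΘΨ − λ·(γ(Ψ)XΨ)·Θ(γ(Ψ)) / γ(Ψ)²`,
  with `Θm = −Θ(γ(Ψ))` (`rotating_angular_m`: `Θ|y|² = 0`, part V) — NO second derivatives of `Ψ` on the right: the outgoing approximate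
  Riemann invariant is transported with zeroth-order sources only (genuinely-nonlinear `γ'(Ψ)ΘΨ·(…)` terms and the geometric term `(Xλ)ΘΨ`
  carrying the growth `m ~ ω²|y|²`, i.e. John's `r^{-1/2}` normalisation after dividing by `λ`).
* `rotating_riemann_transport_neg` — the twin for `w₋ = γ(Ψ)XΨ − λ ΘΨ` along `X + (λ/γ(Ψ))Θ`.

What F3 still needs (not here): the integral curves of `X ∓ (λ/γ(Ψ))Θ` in the exterior as global forward characteristics (radius strictly
increasing along them), and the rewriting of the sources as `−a w₊² + (cross terms) + O(|y|⁻²)` feeding `…ZShockRiccatiForced`. [folklore]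
(John 1974 §2; Hörmander 1997 §4.2)
-/

noncomputable section

namespace Summit.NavierStokesRegularity.NavierStokesRegularity.Theorems.PoloidalWindowDoorPoloidalWindowRigidityZShockRotatingProfileRiemann

-- the summit and its single sub-problem share the name (CONVENTIONS §1)
set_option linter.dupNamespace false

open Set Filter Topology
open Summit.NavierStokesRegularity.NavierStokesRegularity.Theorems.PoloidalWindowDoorPoloidalWindowRigidityZShockRotatingProfileLogPolar Summit.NavierStokesRegularity.NavierStokesRegularity.Theorems.PoloidalWindowDoorPoloidalWindowRigidityZShockRotatingProfileAngularMomentum Summit.NavierStokesRegularity.NavierStokesRegularity.Theorems.PoloidalWindowDoorPoloidalWindowRigidityZShockRotatingProfileTransport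

variable {Ψ : EuclideanSpace ℝ (Fin 2) → ℝ} {γ : ℝ → ℝ} {J : EuclideanSpace ℝ (Fin 2) → EuclideanSpace ℝ (Fin 2)} {ω : ℝ}

/-- `Θm = −Θ(γ(Ψ))` for `m = ω²|y|² − γ(Ψ)` (the angular derivative kills `|y|²`, part V). [folklore] -/
theorem rotating_angular_m (hΨ : ContDiff ℝ 2 Ψ) (hγ : ContDiff ℝ 1 γ)
    (hJ : ∀ y' : EuclideanSpace ℝ (Fin 2), J y' = (-(y' 1)) • EuclideanSpace.single (0 : Fin 2) (1 : ℝ) +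
      (y' 0) • EuclideanSpace.single (1 : Fin 2) (1 : ℝ)) (y : EuclideanSpace ℝ (Fin 2)) :
    fderiv ℝ (fun y' : EuclideanSpace ℝ (Fin 2) => ω ^ 2 * ‖y'‖ ^ 2 - γ (Ψ y')) y (J y) =
      -fderiv ℝ (fun y' => γ (Ψ y')) y (J y) := by
  have hΨd : Differentiable ℝ Ψ := hΨ.differentiable two_ne_zero
  have hγΨd : Differentiable ℝ fun y' => γ (Ψ y') := (hγ.differentiable one_ne_zero).comp hΨd
  have hnd : Differentiable ℝ fun x' : EuclideanSpace ℝ (Fin 2) => ‖x'‖ ^ 2 :=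
    (contDiff_norm_sq ℝ (n := 1)).differentiable one_ne_zero
  have h : HasFDerivAt (fun y' : EuclideanSpace ℝ (Fin 2) => ω ^ 2 * ‖y'‖ ^ 2 - γ (Ψ y'))
      (ω ^ 2 • fderiv ℝ (fun x' : EuclideanSpace ℝ (Fin 2) => ‖x'‖ ^ 2) y - fderiv ℝ (fun y' => γ (Ψ y')) y) y :=
    ((hnd y).hasFDerivAt.const_mul (ω ^ 2)).sub (hγΨd y).hasFDerivAt
  rw [h.fderiv]
  simp only [_root_.sub_apply, _root_.smul_apply, smul_eq_mul, fderiv_normSq_angular hJ y, mul_zero, zero_sub]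

/-- ★ **Transport of the outgoing approximate Riemann invariant** `w₊ = γ(Ψ)XΨ + λΘΨ`, `λ = √((ω²|y|² − γ(Ψ))γ(Ψ))`, at a point of
the hyperbolic exterior (`γ(Ψ(y)) < ω²|y|²`) of a rotating profile: `X w₊ − (λ/γ(Ψ))Θ w₊` equals
`(Θm + Xλ − (λ/γ(Ψ))Θλ)·ΘΨ − λ·(γ(Ψ)XΨ)·Θ(γ(Ψ))/γ(Ψ)²` — no second derivative of `Ψ` remains. [folklore] -/
theorem rotating_riemann_transport (hΨ : ContDiff ℝ 2 Ψ) (hγ : ContDiff ℝ 1 γ)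
    (hJ : ∀ y' : EuclideanSpace ℝ (Fin 2), J y' = (-(y' 1)) • EuclideanSpace.single (0 : Fin 2) (1 : ℝ) +
      (y' 0) • EuclideanSpace.single (1 : Fin 2) (1 : ℝ))
    (hrot : ∀ y : EuclideanSpace ℝ (Fin 2),
      ω ^ 2 * fderiv ℝ (fun y' => fderiv ℝ Ψ y' (J y')) y (J y) =
        ∑ i, fderiv ℝ (fun y' => γ (Ψ y') * fderiv ℝ Ψ y' (EuclideanSpace.single i 1)) y (EuclideanSpace.single i 1))
    (hγpos : ∀ r, 0 < γ r) (y : EuclideanSpace ℝ (Fin 2)) (hext : γ (Ψ y) < ω ^ 2 * ‖y‖ ^ 2) :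
    fderiv ℝ (fun y' : EuclideanSpace ℝ (Fin 2) => γ (Ψ y') * fderiv ℝ Ψ y' y' + Real.sqrt ((ω ^ 2 * ‖y'‖ ^ 2 - γ (Ψ y')) * γ (Ψ y')) * fderiv ℝ Ψ y' (J y')) y y - Real.sqrt ((ω ^ 2 * ‖y‖ ^ 2 - γ (Ψ y)) * γ (Ψ y)) / γ (Ψ y) * fderiv ℝ (fun y' : EuclideanSpace ℝ (Fin 2) => γ (Ψ y') * fderiv ℝ Ψ y' y' + Real.sqrt ((ω ^ 2 * ‖y'‖ ^ 2 - γ (Ψ y')) * γ (Ψ y')) * fderiv ℝ Ψ y' (J y')) y (J y) =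
      (fderiv ℝ (fun y' : EuclideanSpace ℝ (Fin 2) => ω ^ 2 * ‖y'‖ ^ 2 - γ (Ψ y')) y (J y) +
          fderiv ℝ (fun y' : EuclideanSpace ℝ (Fin 2) => Real.sqrt ((ω ^ 2 * ‖y'‖ ^ 2 - γ (Ψ y')) * γ (Ψ y'))) y y -
          Real.sqrt ((ω ^ 2 * ‖y‖ ^ 2 - γ (Ψ y)) * γ (Ψ y)) / γ (Ψ y) * fderiv ℝ (fun y' : EuclideanSpace ℝ (Fin 2) => Real.sqrt ((ω ^ 2 * ‖y'‖ ^ 2 - γ (Ψ y')) * γ (Ψ y'))) y (J y)) *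
        fderiv ℝ Ψ y (J y) -
      Real.sqrt ((ω ^ 2 * ‖y‖ ^ 2 - γ (Ψ y)) * γ (Ψ y)) * (γ (Ψ y) * fderiv ℝ Ψ y y) * fderiv ℝ (fun y' => γ (Ψ y')) y (J y) / γ (Ψ y) ^ 2 := by
  have hJ' : J = fun y' => (-(y' 1)) • EuclideanSpace.single (0 : Fin 2) (1 : ℝ) +
      (y' 0) • EuclideanSpace.single (1 : Fin 2) (1 : ℝ) := funext hJ
  have hJc : ContDiff ℝ 1 J := by rw [hJ']; fun_prop
  have hΨd : Differentiable ℝ Ψ := hΨ.differentiable two_ne_zero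
  have hDΨ : ContDiff ℝ 1 (fderiv ℝ Ψ) := hΨ.fderiv_right (m := 1) le_rfl
  have hqd : Differentiable ℝ fun y' => fderiv ℝ Ψ y' (J y') := (hDΨ.clm_apply hJc).differentiable one_ne_zero
  have hXd : Differentiable ℝ fun y' => fderiv ℝ Ψ y' y' := (hDΨ.clm_apply contDiff_id).differentiable one_ne_zero
  have hγΨd : Differentiable ℝ fun y' => γ (Ψ y') := (hγ.differentiable one_ne_zero).comp hΨd
  have hnd : Differentiable ℝ fun x' : EuclideanSpace ℝ (Fin 2) => ‖x'‖ ^ 2 :=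
    (contDiff_norm_sq ℝ (n := 1)).differentiable one_ne_zero
  have hmd : Differentiable ℝ fun y' : EuclideanSpace ℝ (Fin 2) => ω ^ 2 * ‖y'‖ ^ 2 - γ (Ψ y') := (hnd.const_mul _).sub hγΨd
  have hpd : Differentiable ℝ fun y' => γ (Ψ y') * fderiv ℝ Ψ y' y' := hγΨd.mul hXd
  have hpos : 0 < (ω ^ 2 * ‖y‖ ^ 2 - γ (Ψ y)) * γ (Ψ y) := mul_pos (sub_pos.2 hext) (hγpos _)
  have hlamd : DifferentiableAt ℝ (fun y' : EuclideanSpace ℝ (Fin 2) => Real.sqrt ((ω ^ 2 * ‖y'‖ ^ 2 - γ (Ψ y')) * γ (Ψ y'))) y :=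
    ((hmd.mul hγΨd) y).sqrt hpos.ne'
  have hlam2 : (fun y' : EuclideanSpace ℝ (Fin 2) => Real.sqrt ((ω ^ 2 * ‖y'‖ ^ 2 - γ (Ψ y')) * γ (Ψ y'))) y ^ 2 =
      (fun y' : EuclideanSpace ℝ (Fin 2) => ω ^ 2 * ‖y'‖ ^ 2 - γ (Ψ y')) y * (fun y' => γ (Ψ y')) y :=
    Real.sq_sqrt hpos.le
  -- the two exterior first-order relations (parts II and V)
  have hXp : fderiv ℝ (fun y' => γ (Ψ y') * fderiv ℝ Ψ y' y') y y =
      fderiv ℝ (fun y' => (fun y' : EuclideanSpace ℝ (Fin 2) => ω ^ 2 * ‖y'‖ ^ 2 - γ (Ψ y')) y' *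
        (fun y' => fderiv ℝ Ψ y' (J y')) y') y (J y) :=
    rotating_profile_equation_logpolar hΨ hγ hJ hrot y
  have hfun : (fun y' => (fun y' => γ (Ψ y') * fderiv ℝ Ψ y' y') y' / (fun y' => γ (Ψ y')) y') =
      fun y' => fderiv ℝ Ψ y' y' := funext fun y' => mul_div_cancel_left₀ _ (hγpos _).ne'
  have hXq : fderiv ℝ (fun y' => fderiv ℝ Ψ y' (J y')) y y =
      fderiv ℝ (fun y' => (fun y' => γ (Ψ y') * fderiv ℝ Ψ y' y') y' / (fun y' => γ (Ψ y')) y') y (J y) := by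
    rw [hfun]
    exact radial_angular_commute hΨ hJ y
  exact transport_identity (p := fun y' => γ (Ψ y') * fderiv ℝ Ψ y' y') (q := fun y' => fderiv ℝ Ψ y' (J y'))
    (m := fun y' : EuclideanSpace ℝ (Fin 2) => ω ^ 2 * ‖y'‖ ^ 2 - γ (Ψ y')) (a := fun y' => γ (Ψ y'))
    (lam := fun y' : EuclideanSpace ℝ (Fin 2) => Real.sqrt ((ω ^ 2 * ‖y'‖ ^ 2 - γ (Ψ y')) * γ (Ψ y'))) (J := J) y
    (hpd y) (hqd y) (hmd y) (hγΨd y) hlamd (hγpos _).ne' hXp hXq hlam2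

/-- **Twin: the incoming approximate Riemann invariant** `w₋ = γ(Ψ)XΨ − λΘΨ` along `X + (λ/γ(Ψ))Θ`:
`X w₋ + (λ/γ(Ψ))Θ w₋ = (Θm − Xλ − (λ/γ(Ψ))Θλ)·ΘΨ + λ·(γ(Ψ)XΨ)·Θ(γ(Ψ))/γ(Ψ)²` at every exterior point. [folklore] -/
theorem rotating_riemann_transport_neg (hΨ : ContDiff ℝ 2 Ψ) (hγ : ContDiff ℝ 1 γ)
    (hJ : ∀ y' : EuclideanSpace ℝ (Fin 2), J y' = (-(y' 1)) • EuclideanSpace.single (0 : Fin 2) (1 : ℝ) +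
      (y' 0) • EuclideanSpace.single (1 : Fin 2) (1 : ℝ))
    (hrot : ∀ y : EuclideanSpace ℝ (Fin 2),
      ω ^ 2 * fderiv ℝ (fun y' => fderiv ℝ Ψ y' (J y')) y (J y) =
        ∑ i, fderiv ℝ (fun y' => γ (Ψ y') * fderiv ℝ Ψ y' (EuclideanSpace.single i 1)) y (EuclideanSpace.single i 1))
    (hγpos : ∀ r, 0 < γ r) (y : EuclideanSpace ℝ (Fin 2)) (hext : γ (Ψ y) < ω ^ 2 * ‖y‖ ^ 2) :
    fderiv ℝ (fun y' : EuclideanSpace ℝ (Fin 2) => γ (Ψ y') * fderiv ℝ Ψ y' y' - Real.sqrt ((ω ^ 2 * ‖y'‖ ^ 2 - γ (Ψ y')) * γ (Ψ y')) * fderiv ℝ Ψ y' (J y')) y y + Real.sqrt ((ω ^ 2 * ‖y‖ ^ 2 - γ (Ψ y)) * γ (Ψ y)) / γ (Ψ y) * fderiv ℝ (fun y' : EuclideanSpace ℝ (Fin 2) => γ (Ψ y') * fderiv ℝ Ψ y' y' - Real.sqrt ((ω ^ 2 * ‖y'‖ ^ 2 - γ (Ψ y')) * γ (Ψ y')) *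 fderiv ℝ Ψ y' (J y')) y (J y) =
      (fderiv ℝ (fun y' : EuclideanSpace ℝ (Fin 2) => ω ^ 2 * ‖y'‖ ^ 2 - γ (Ψ y')) y (J y) -
          fderiv ℝ (fun y' : EuclideanSpace ℝ (Fin 2) => Real.sqrt ((ω ^ 2 * ‖y'‖ ^ 2 - γ (Ψ y')) * γ (Ψ y'))) y y -
          Real.sqrt ((ω ^ 2 * ‖y‖ ^ 2 - γ (Ψ y)) * γ (Ψ y)) / γ (Ψ y) * fderiv ℝ (fun y' : EuclideanSpace ℝ (Fin 2) => Real.sqrt ((ω ^ 2 * ‖y'‖ ^ 2 - γ (Ψ y')) * γ (Ψ y'))) y (J y)) *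
        fderiv ℝ Ψ y (J y) +
      Real.sqrt ((ω ^ 2 * ‖y‖ ^ 2 - γ (Ψ y)) * γ (Ψ y)) * (γ (Ψ y) * fderiv ℝ Ψ y y) * fderiv ℝ (fun y' => γ (Ψ y')) y (J y) / γ (Ψ y) ^ 2 := by
  have hJ' : J = fun y' => (-(y' 1)) • EuclideanSpace.single (0 : Fin 2) (1 : ℝ) +
      (y' 0) • EuclideanSpace.single (1 : Fin 2) (1 : ℝ) := funext hJ
  have hJc : ContDiff ℝ 1 J := by rw [hJ']; fun_prop
  have hΨd : Differentiable ℝ Ψ := hΨ.differentiable two_ne_zero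
  have hDΨ : ContDiff ℝ 1 (fderiv ℝ Ψ) := hΨ.fderiv_right (m := 1) le_rfl
  have hqd : Differentiable ℝ fun y' => fderiv ℝ Ψ y' (J y') := (hDΨ.clm_apply hJc).differentiable one_ne_zero
  have hXd : Differentiable ℝ fun y' => fderiv ℝ Ψ y' y' := (hDΨ.clm_apply contDiff_id).differentiable one_ne_zero
  have hγΨd : Differentiable ℝ fun y' => γ (Ψ y') := (hγ.differentiable one_ne_zero).comp hΨd
  have hnd : Differentiable ℝ fun x' : EuclideanSpace ℝ (Fin 2) => ‖x'‖ ^ 2 :=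
    (contDiff_norm_sq ℝ (n := 1)).differentiable one_ne_zero
  have hmd : Differentiable ℝ fun y' : EuclideanSpace ℝ (Fin 2) => ω ^ 2 * ‖y'‖ ^ 2 - γ (Ψ y') := (hnd.const_mul _).sub hγΨd
  have hpd : Differentiable ℝ fun y' => γ (Ψ y') * fderiv ℝ Ψ y' y' := hγΨd.mul hXd
  have hpos : 0 < (ω ^ 2 * ‖y‖ ^ 2 - γ (Ψ y)) * γ (Ψ y) := mul_pos (sub_pos.2 hext) (hγpos _)
  have hlamd : DifferentiableAt ℝ (fun y' : EuclideanSpace ℝ (Fin 2) => Real.sqrt ((ω ^ 2 * ‖y'‖ ^ 2 - γ (Ψ y')) * γ (Ψ y'))) y :=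
    ((hmd.mul hγΨd) y).sqrt hpos.ne'
  have hlam2 : (fun y' : EuclideanSpace ℝ (Fin 2) => Real.sqrt ((ω ^ 2 * ‖y'‖ ^ 2 - γ (Ψ y')) * γ (Ψ y'))) y ^ 2 =
      (fun y' : EuclideanSpace ℝ (Fin 2) => ω ^ 2 * ‖y'‖ ^ 2 - γ (Ψ y')) y * (fun y' => γ (Ψ y')) y :=
    Real.sq_sqrt hpos.le
  -- the two exterior first-order relations (parts II and V)
  have hXp : fderiv ℝ (fun y' => γ (Ψ y') * fderiv ℝ Ψ y' y') y y =
      fderiv ℝ (fun y' => (fun y' : EuclideanSpace ℝ (Fin 2) => ω ^ 2 * ‖y'‖ ^ 2 - γ (Ψ y')) y' *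
        (fun y' => fderiv ℝ Ψ y' (J y')) y') y (J y) :=
    rotating_profile_equation_logpolar hΨ hγ hJ hrot y
  have hfun : (fun y' => (fun y' => γ (Ψ y') * fderiv ℝ Ψ y' y') y' / (fun y' => γ (Ψ y')) y') =
      fun y' => fderiv ℝ Ψ y' y' := funext fun y' => mul_div_cancel_left₀ _ (hγpos _).ne'
  have hXq : fderiv ℝ (fun y' => fderiv ℝ Ψ y' (J y')) y y =
      fderiv ℝ (fun y' => (fun y' => γ (Ψ y') * fderiv ℝ Ψ y' y') y' / (fun y' => γ (Ψ y')) y') y (J y) := by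
    rw [hfun]
    exact radial_angular_commute hΨ hJ y
  exact transport_identity_neg (p := fun y' => γ (Ψ y') * fderiv ℝ Ψ y' y') (q := fun y' => fderiv ℝ Ψ y' (J y'))
    (m := fun y' : EuclideanSpace ℝ (Fin 2) => ω ^ 2 * ‖y'‖ ^ 2 - γ (Ψ y')) (a := fun y' => γ (Ψ y'))
    (lam := fun y' : EuclideanSpace ℝ (Fin 2) => Real.sqrt ((ω ^ 2 * ‖y'‖ ^ 2 - γ (Ψ y')) * γ (Ψ y'))) (J := J) y
    (hpd y) (hqd y) (hmd y) (hγΨd y) hlamd (hγpos _).ne' hXp hXq hlam2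

end Summit.NavierStokesRegularity.NavierStokesRegularity.Theorems.PoloidalWindowDoorPoloidalWindowRigidityZShockRotatingProfileRiemann
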